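/-
Copyright (c) 2026. All rights reserved.
Released under Apache 2.0 license as described in the file LICENSE.
Authors: abc-iut cell, prover seat abc-iut-w4-d095 (gen 7; row «SB′-CONTACT», abc-iut-L4-lead m136), over this seat's sufficiency
file and the genuine-carrier instances of abc-iut-f-101, abc-iut-L4-t3, abc-iut-w5-d053 and abc-iut-w5-d144 (nothing restated).
-/
import Literature.AnabelianGeometry.AbsoluteAnabelian.LogFrobeniusMonoTelecoreContactObservables
import Literature.AnabelianGeometry.AbsoluteAnabelian.LogFrobeniusMonoGenuineSubObservablesTS
import Literature.AnabelianGeometry.AbsoluteAnabelian.LogFrobeniusMonoGenuineSubIotaOver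
import HarnessLib

/-!
# [AbsTopIII] Corollary 5.10 (iv)(c), observable clause, at the GENUINE open-augmentation carrier

S. Mochizuki, *Topics in absolute anabelian geometry III: global reconstruction algorithms*,
J. Math. Sci. Univ. Tokyo 22 (2015) 939–1156 [MochizukiAbsTopIII2015]; manuscript `paper:url-5493eb38cbb7`: Cor 5.10 (iv)(c)
p. 148 l. 39–51; Cor 5.5 (iii) p. 131; Def 5.4 (iii)/(vii) pp. 126–128.

WHY THIS FILE (row «SB′-CONTACT», brick D; MODEL-LEVEL, proof-only).  abc-iut-w5-d144's typed statement
`Cor510MonoContactObservablesCompatible` (Cor 5.10 (iv)(c): the contact structure `ℋ_{An⊢}` of the mono-analytic telecore is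
compatible with the `Γ⃗×_v`-indexed homotopies of the observables `S_log`, `S_log⊞`) HOLDS at abc-iut-f-101's genuine
nonarchimedean open-augmentation carrier `genuineOpen p V` (`V ≠ ∅`), for EVERY `TS`-datum: this seat's sufficiency
`MonoTelecoreCoherence.cor510MonoContactObservablesCompatible_of` fed BY NAME with abc-iut-f-101's coherence datum
`monoTelecoreCoherence_open`, the genuine `ι^{An⊢⊞}`-data `nonarchGenuineMonoAnPfOpen_iotaAnMono` (abc-iut-w5-d053 /
abc-iut-w4-d095), abc-iut-L4-t3's `squaresCommute_genuineOpen` and `etaNatural_genuineOpen`, abc-iut-w5-d144's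
`nonarchGenuineMonoAnPfOpen_iotaOver`, and abc-iut-w5-d144 / abc-iut-w5-d053's genuine observables
`genuineOpen_cor55Observables`, `genuineOpen_cor55ObservablesTS`.

* ★ `cor510MonoContactObservablesCompatible_genuineOpen` — the instance; `…_iff` — EXACTLY iff `V ≠ ∅`;
  `exists_genuine_cor510MonoContactObservablesCompatible` — model-level non-vacuity of the typed (c)-clause.

MODEL-LEVEL (a genuine carrier of the cell's own construction; index sets nonarchimedean); refereed pre-IUT material; OUR kernel
check; nothing here bears on [IUTchIII] Cor. 3.12; no side taken; typed ≠ proved elsewhere.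
-/

set_option autoImplicit false

open CategoryTheory

namespace Literature.AnabelianGeometry.AbsoluteAnabelian

namespace LogFrobeniusSetting

open AbsTopIII

section Instance

variable (p : ℕ) [Fact p.Prime] (Vmod : Type 1)

/-- ★ **Cor 5.10 (iv)(c), observable clause, HOLDS at the genuine open-augmentation carrier** `genuineOpen p V` (`V ≠ ∅`), for every
`TS`-datum `T`: one family of homotopies on `D_{An⊢}` contains the telecore family `𝒥`, a contact structure `ℋ_{An⊢}` with the printed
pairs, and the `Γ⃗×_v`-indexed pairs of observable structures `S_log⊞_v`, `S_log_v`.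
[cite: MochizukiAbsTopIII2015, Cor 5.10 (iv)(c) p. 148] -/
theorem cor510MonoContactObservablesCompatible_genuineOpen [Nonempty Vmod] (T : (genuineOpen p Vmod).TSHomotopies) :
    (genuineOpen p Vmod).Cor510MonoContactObservablesCompatible T :=
  (monoTelecoreCoherence_open p Vmod).cor510MonoContactObservablesCompatible_of
    (nonarchGenuineMonoAnPfOpen_iotaAnMono p Vmod (fun _ => false)) (squaresCommute_genuineOpen p Vmod)
    (etaNatural_genuineOpen p Vmod) (nonarchGenuineMonoAnPfOpen_iotaOver p Vmod (fun _ => false)) T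
    (genuineOpen_cor55Observables p Vmod) (genuineOpen_cor55ObservablesTS p Vmod T)

/-- … in particular for the carrier's own `TS`-datum `genuineOpenTS`. [cite: MochizukiAbsTopIII2015, Cor 5.10 (iv)(c) p. 148] -/
theorem cor510MonoContactObservablesCompatible_genuineOpen_self [Nonempty Vmod] :
    (genuineOpen p Vmod).Cor510MonoContactObservablesCompatible (genuineOpenTS p Vmod) :=
  cor510MonoContactObservablesCompatible_genuineOpen p Vmod _

/-- **the statement at the genuine carrier EXACTLY**: it holds iff `V ≠ ∅` (abc-iut-w5-d144's degenerate corner).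
[cite: MochizukiAbsTopIII2015, Cor 5.10 (iv)(c) p. 148] -/
theorem cor510MonoContactObservablesCompatible_genuineOpen_iff (T : (genuineOpen p Vmod).TSHomotopies) :
    (genuineOpen p Vmod).Cor510MonoContactObservablesCompatible T ↔ Nonempty Vmod :=
  (monoTelecoreCoherence_open p Vmod).cor510MonoContactObservablesCompatible_iff_nonempty
    (nonarchGenuineMonoAnPfOpen_iotaAnMono p Vmod (fun _ => false)) (squaresCommute_genuineOpen p Vmod)
    (etaNatural_genuineOpen p Vmod) (nonarchGenuineMonoAnPfOpen_iotaOver p Vmod (fun _ => false)) T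
    (genuineOpen_cor55Observables p Vmod) (genuineOpen_cor55ObservablesTS p Vmod T)

end Instance

/-- Hence a §5 setting with `V(F_mod) ≠ ∅` and a `TS`-datum satisfying the typed (c)-clause EXIST (model-level non-vacuity).
[cite: MochizukiAbsTopIII2015, Cor 5.10 (iv)(c) p. 148] -/
theorem exists_genuine_cor510MonoContactObservablesCompatible (p : ℕ) [Fact p.Prime] (Vmod : Type 1) [Nonempty Vmod] :
    ∃ (L : LogFrobeniusSetting Vmod (fun _ => false)) (T : L.TSHomotopies), L.Cor510MonoContactObservablesCompatible T :=
  ⟨genuineOpen p Vmod, genuineOpenTS p Vmod, cor510MonoContactObservablesCompatible_genuineOpen_self p Vmod⟩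

end LogFrobeniusSetting

end Literature.AnabelianGeometry.AbsoluteAnabelian
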